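import Literature.NumberTheory.DiophantineGeometry.Bcgp2025ModThreeImageOrder2304
import Literature.NumberTheory.GaloisRepresentations.GSp4DecompositionStabilizer
import Literature.NumberTheory.GaloisRepresentations.GSp4DecompositionStabilizerCard
import HarnessLib

/-!
# Boxer–Calegari–Gee–Pilloni 2025, Theorem 9.5.2 for the listed mod-`3` image `3.45.1`
# (the stabiliser `N_dec` of a non-degenerate decomposition `𝔽₃⁴ = P ⊕ P^⊥`), in the STRUCTURAL
# form a per-curve certificate states — PROVED from the tree's facts, no new named fact

Topic `Literature/NumberTheory/DiophantineGeometry`, sibling of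
`Bcgp2025ModThreeListedImageModular.lean` (Theorem 9.5.2 in its general 15-subgroup form, the fact
`bcgp2025_modThreeListedImage_modular_abelianSurface`, whose hypothesis (1) "the image of `ρ̄_{A,3}`
is one of the 15 subgroups listed in Lemma 6.4.3" is rendered THROUGH Lemma 6.4.3 as
"`GSp₄`-reasonable ∧ tidy ∧ regular semisimple elements in `Γ` and in `Γ′ ∖ Γ` ∧ `Γ` absolutely
irreducible") and of `Bcgp2025ModThreeImageOrder2304.lean` (the cell's ONE named fact for the row
`3.45.1` of Table 6.4.4, `bcgp2025_lemma643_modThreeImage_order2304`: good reduction at `3` and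
`|ρ̄_{A,3}(G_ℚ)| = 2304` ⟹ those five conditions — the ORDER form).  THIS FILE HAS NO NAMED FACT
(D-0026, and the cell's ruling "one typed entry point of record per printed row",
`run/shared/lean/pub/pub-residmod/INBOX.md` R86/R87): it PROVES, from those two facts, the
STRUCTURAL entry point — image `=` the stabiliser in `GSp(J)(𝔽₃)` of a non-degenerate plane pair
`{P, P^⊥}` two-sidedly (`FramedGaloisRep.HasDecompositionStabilizerImage`,
`GaloisRepresentations/GSp4DecompositionStabilizer.lean`), which is literally what the cell's image
certificate for such a curve says (upper bound: a Galois-stable non-degenerate pair of planes in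
`A[3]`; lower bound: the image escapes every maximal subclass of `N_dec`).  The first three
theorems carry ONE explicit finite-group hypothesis `hSO` ("(S⇒O)": the similitudes of an invertible
alternating `J` on `𝔽₃⁴` stabilising a non-degenerate pair `{P, P^⊥}` number `2304`; elementary —
`2 · #{(a, b) ∈ GL₂(𝔽₃)² : det a = det b} = 2304` after a basis adapted to `P ⊕ P^⊥`) as a binder;
(S⇒O) is now PROVED in the tree (`GSp4DecompStabCount.card_stabSet`, whence
`natCard_GL_similitude_stabilizesPlanePair` — character for character the type of `hSO` —,
`GaloisRepresentations/GSp4DecompositionStabilizerCard.lean`, the cell's LIT-2 seat), and the last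
three theorems of this file (`card_imageOn_top_eq_2304_of_hasDecompositionStabilizerImage`,
`bcgp2025_modThreeDecompositionImage_liftingConditions`,
`bcgp2025_modThreeDecompositionImage_modular`) are the same statements WITH `hSO` DISCHARGED — the
forms a consumer should use; the `hSO`-forms are kept for existing importers.  Vendored by the literature seat of
the venture cell `pub-residmod` (`run/shared/lean/pub/pub-residmod/lit/BCGP-AS-PRINTED.md` §B3, §D):
the printed instance is the curve of conductor `7889 = 7³ · 23` of §10.1 (LMFDB `7889.b.55223.1`,
mod-`3` image `3.45.1` of order `2304`), "precisely one of which we can deduce is modular by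
Theorem 9.5.2".

## The printed statements (G. Boxer, F. Calegari, T. Gee, V. Pilloni, *Modularity theorems for
## abelian surfaces*, arXiv:2502.20645; chunk ids of the held TeX rendering `paper:arxiv-2502.20645`,
## not PDF pages; numbering per the arXiv v1 source counters, cell file `lit/LIT2-RESIDUAL-MODULARITY.md` §8)

* **Lemma 6.4.2** (label `imageonly`; chunk p0102 L57–79), verbatim: "Suppose that `A/ℚ` is an
  abelian surface, and that `A` has good reduction at some `p > 2`. Then the image of
  `ρ̄_{A,p}|_{G_{ℚ(ζ_p)}}` coincides with the image of `ρ̄_{A,p}|_{G_{ℚ(ζ_{p^n})}}` for all `n ≥ 1`."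
  (Proof printed: if `ℚ_p(ζ_{p²}) ⊆ K`, the splitting field of `ρ̄_{A,p}|_{G_{ℚ_p}}`, the root
  discriminant of `K` would be at least that of `ℚ(ζ_{p²})`, `v_p = 1 + 1/(p−1) + (p−3)/(p−1)`,
  contradicting Fontaine's bound `v_p(δ_K) < 1 + 1/(p−1)` for the finite flat group scheme
  `A[p]/ℤ_p` [MR807070].)  This is why `GSp₄`-reasonableness — "which a priori depends on the image
  of `ρ̄|_{G(ℚ(ζ_{3^n}))}` for all `n`" (proof of Lemma 6.4.3, chunk p0103 L21–24) — is a property of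
  the image `Γ′` alone under good reduction at `3`.
* **Lemma 6.4.3** (label `listofsubgroups`; chunk p0102 L83–109), verbatim: "Let `A/ℚ` be an
  abelian surface with a prime to `3` polarization and good reduction at `3`, and let
  `ρ̄ = ρ̄_{A,3} : G_ℚ → GSp₄(𝔽₃)` denote the corresponding mod `3` representation. Then the
  following hypotheses: (1) `ρ̄` is `GSp₄`-reasonable in the sense of [Whitmore, Defn. 3.19],
  (2) `ρ̄` is tidy in the sense of [BCGP, Defn. 7.5.11], (3) `ρ̄(G_{ℚ(ζ₃)})` contains a regular
  semi-simple element, (4) `ρ̄(G_ℚ) ∖ ρ̄(G_{ℚ(ζ₃)})` contains a regular semi-simple element, are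
  satisfied precisely if `Γ′ = ρ̄(G_ℚ)` in Table [6.4.4] has a tick, where otherwise the cross
  indicates the corresponding obstruction to condition (1), (2), (3), or (4)."  Its proof adds
  (chunk p0103 L25–26): "As noted in [Whitmore], the spanning condition of reasonableness is
  satisfied for all of these subgroups."
* **Table 6.4.4** (label `tabletwo`; arXiv e-print source, cell transcription
  `lit/BCGP25-Lemma6.4.3-Table6.4.4-source.tex`), caption verbatim: "Conjugacy classes of subgroups
  `Γ′ ⊂ GSp₄(𝔽₃)` with `ν(Γ′) ≠ 1` and `Γ = Γ′ ∩ Sp₄(𝔽₃)` absolutely irreducible. LMFDB labels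
  determine the conjugacy class of `Γ′`, the small group labels [MR1826989] determine `Γ`, `Γ′` up
  to abstract isomorphism."  The row used here, verbatim from the source:
  `\texttt{3.45.1} & $ 2304$ & $1152$ &    &    &   & & \TTTT` — LMFDB label `3.45.1`,
  `|Γ′| = 2304`, `|Γ| = 1152`, no cross in columns (1)–(4), tick.  Label convention (proof of
  Lemma 6.4.3, chunk p0103 L29–31): "`3.i.n` where `i = [GSp₄(𝔽₃):Γ′]`"; `103680 / 45 = 2304`, and
  `3.45.1` is the only row of index `45`.
* **Theorem 9.5.2** (label `firstlater`; chunk p0136 L95–117): quoted in full in the sibling's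
  module docstring; hypothesis (1): "The image of the mod `3` representation
  `ρ̄_{A,3} : Gal(ℚ̄/ℚ) → GSp₄(𝔽₃)` is one of the `15` subgroups listed in Lemma [6.4.3], and
  `End(A_ℚ̄) = ℤ`."
* **§10.1** (chunk p0138 L91–104), verbatim: "If one allows `ρ̄_{A,3}` to be any of the `15`
  subgroups listed in Lemma [6.4.3], there are three additional curves, precisely one of which we
  can deduce is modular by Theorem [9.5.2]. This is the curve of conductor `7³ · 23`. The
  representation `ρ̄_{A,3}` in this case (with image of order `2304`) is induced from a
  representation `ρ̄_{E,3} : G_F → GL₂(𝔽₃)`, where `E` is a modular elliptic curve over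
  `F = ℚ(√−7)`".

## Rendering (what reviewers should attack)

THE CLASS.  `N_dec := Stab_{GSp(J)(𝔽₃)}({P, P^⊥})` for a non-degenerate plane `P`
(`Submodule.IsNondegeneratePlane J P`: `dim P = 2`, `𝔽₃⁴ = P ⊕ P^⊥`) is the class `3.45.1` of the
table: it has order `2 · #{(a, b) ∈ GL₂(𝔽₃)² : det a = det b} = 2304 = 103680/45`, `ν(N_dec) =
𝔽₃ˣ`, `Γ = N_dec ∩ Sp₄(𝔽₃) = (SL₂(𝔽₃) × SL₂(𝔽₃)) ⋊ 2` of order `1152` is absolutely irreducible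
and contains `−1` (elementary; machine-checked by the cell, `lit/ndec_check_litg3.py`: every
`Γ`-orbit spans `𝔽₃⁴`, commutant `= 𝔽₃`; `144` regular semisimple elements in `Γ`, all of
characteristic polynomial `X⁴ + 1` — the order-`8` class of Lemma 6.4.1 —, `504` in `N_dec ∖ Γ`,
`72` tidy witnesses with `ν = −1`), so it IS one of the 25 rows of the complete Table 6.4.4
(caption), the unique one of index `45`; the cell's two independent reconstructions of the subgroup
lattice of `GSp₄(𝔽₃)` name the same maximal class ("stabiliser of a non-degenerate decomposition
⊥-sum of two planes (2304, 45)", `cert/CERT-FORMAT-v1.md` §3b).  Since `−1 ∈ N_dec` the class does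
not depend on reading the image on `A[3]` or on `H¹(A_ℚ̄, 𝔽₃) = A[3]^∨` (§1.8.23).

THE BRIDGE `card_imageOn_top_eq_of_hasDecompositionStabilizerImage` (PROVED): if `ρb` is
symplectic for `J` with multiplier `ε̄⁻¹` and `ρb.HasDecompositionStabilizerImage J`, then the image
`ρb.imageOn ⊤` is, as a subset of `GL₄(𝔽₃)`, exactly `{M : similitude of J stabilising {P, P^⊥}}`
(the two halves of the predicate plus symplecticity), so `Nat.card (ρb.imageOn ⊤)` equals the
number of such similitudes — which is `2304` by the explicit hypothesis
`hSO` = "(S⇒O)": for every invertible alternating `J` on `𝔽₃⁴` and every non-degenerate plane `P`,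
`Nat.card {M ∈ GL₄(𝔽₃) : M a similitude of J ∧ StabilizesPlanePair J P M} = 2304`.  WHY (S⇒O) IS
TRUE (now the tree theorem `GSp4DecompStabCount.card_stabSet`; the `hSO`-free form of the bridge is
`card_imageOn_top_eq_2304_of_hasDecompositionStabilizerImage` below): in a basis `e₁, f₁ ∈ P`,
`e₂, f₂ ∈ P^⊥` adapted to the decomposition the similitudes stabilising the pair are the
block-diagonal `(a, b) ∈ GL(P) × GL(P^⊥)` with
`det a = det b (= ν)` — `#{(a, b) ∈ GL₂(𝔽₃)²: det a = det b} = 24·24 + 24·24 = 1152` — and the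
block-anti-diagonal ones (one swap times the former), total `2304 = 103680 / 45`; machine-checked
in `lit/ndec_check_litg3.py` together with: `ν` surjective, `Γ = Γ′ ∩ Sp₄` of order `1152`,
`−1 ∈ Γ`, `Γ` absolutely irreducible (commutant `𝔽₃`), `144` regular semisimple elements in `Γ`
(all of characteristic polynomial `X⁴ + 1`, the order-`8` class of Lemma 6.4.1), `504` in `Γ′ ∖ Γ`,
`72` tidy witnesses.  So under (S⇒O) the structural hypothesis implies `|ρ̄(G_ℚ)| = 2304`, the
hypothesis of the cell's fact of record `bcgp2025_lemma643_modThreeImage_order2304`, whose bridge to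
the printed row is [CCG20, Lemma 2] ("the unique subgroup of order `2304` of `GSp₄(𝔽₃)` up to
conjugacy") + the printed `3.45.1 | 2304`.

THE THEOREM `bcgp2025_modThreeDecompositionImage_liftingConditions_of_order2304` (PROVED from the
fact of record + `hSO`) = Lemma 6.4.3, direction "tick ⟹ (1)–(4)", for the row `3.45.1`, with the
caption's "`Γ` absolutely irreducible", in the STRUCTURAL form.  HYPOTHESES on
`A : AbelianVariety ℚ`, `A.dim = 2`, a torsion frame `(ρ₀, e)` of `A[3](ℚ̄)` and `ρb = ρ₀^∨` (the
source's `ρ̄_{A,3}`), exactly as in the siblings: "good reduction at `3`" = the tree's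
`HasGoodReductionAt A.X A.dim v` at `v ∣ 3` (the shape used for "bad reduction at `2`" in
`bcgp2025_modThreeSurjective_badAtTwo_modular_abelianSurface`; implied by good ordinary reduction,
`HasGoodOrdinaryReductionAt.hasGoodReductionAt`); "a prime to `3` polarization" + "`ρ̄ : G_ℚ →
GSp₄(𝔽₃)`" = the siblings' clause (0): an invertible alternating `J` with `ρb(σ)ᵀ J ρb(σ) =
ε̄(σ)⁻¹ J`; "`Γ′ = ρ̄(G_ℚ)` is `3.45.1`" = `ρb.HasDecompositionStabilizerImage J`.  CONCLUSION =
VERBATIM the five image clauses of hypothesis (1) of `bcgp2025_modThreeListedImage_modular_abelianSurface`: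
`ρb.IsGSp4Reasonable J 3` (Whitmore Def. 3.19), `ρb.IsTidy J` (BCGP 2021 Def. 7.5.11),
`IsAbsIrreducible (ρb.imageOn (galCyclotomicPow ℚ 3 1)).subtype` (`Γ = ρ̄(G_{ℚ(ζ₃)})`), a regular
semisimple element in `ρ̄(G_{ℚ(ζ₃)})`, one in `ρ̄(G_ℚ) ∖ ρ̄(G_{ℚ(ζ₃)})`.
WHY THE STRUCTURAL HYPOTHESES ARE THE PRINTED ONES: the polarization hypothesis of Lemma 6.4.3 is
implied — `Γ′` is irreducible on `A[3]^∨`, so `A[3]` is an irreducible Galois module, so the kernel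
of any polarization `λ` of degree divisible by `3` contains `A[3]` and `λ = 3λ′` with `λ′` again a
polarization (symmetric, and `L′^{⊗3}` algebraically equivalent to ample forces `L′` ample);
descending, `A` has a polarization of degree prime to `3`, and for it `ρ̄_{A,3}` is `GSp`-valued for
a form proportional to `J` (Schur).  Conditions (2)–(4) and the irreducibility are decidable finite
facts about `N_dec` (above); condition (1) (`H⁰ = 0`, the spanning condition, `H¹(Γ, 𝔰𝔭₄^∨) = 0`
for `|Γ| = 1152`, for ALL `G_{ℚ(ζ_{3^n})}`-images — equal to `Γ` by Lemma 6.4.2) is the Magma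
content of the tick (Remark 9.1.5), carried by the fact of record.  The same cohomology vanishing is
printed independently in Whitmore's treatment of INDUCED images (arXiv:2205.05062v4, proof of
Prop. 8.3, p. 73 L21 – p. 74 L5: for `p = 3`, every `G_bad ≤ GSp₄(𝔽₃)` with `G_bad ∩ Sp₄`
absolutely irreducible, `ν` surjective and a reducible index-`2` subgroup — `N_dec` is such, its
index-`2` subgroup fixing `P` being reducible — has "`H¹(G_bad ∩ Sp₄(𝔽_p), 𝔰𝔭₄) = 0`" and "for
every normal subgroup `H_bad ⊂ G_bad ∩ Sp₄(𝔽_p)` of index 3 or index 9 we have `H¹(H_bad, 𝔰𝔭₄) = 0`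
and `H_bad` is absolutely `GL₄`-irreducible. A further computation shows that this is always the
case." — "As computed in magma").

THE THEOREM `bcgp2025_modThreeDecompositionImage_modular_abelianSurface` = **Theorem 9.5.2 for the
row `3.45.1`**, PROVED from the general fact `bcgp2025_modThreeListedImage_modular_abelianSurface`,
the fact of record `bcgp2025_lemma643_modThreeImage_order2304` and `hSO`: hypotheses (0)+(1)
`J`-symplectic with multiplier `ε̄⁻¹` AND image `= N_dec` (`HasDecompositionStabilizerImage`),
`End(A_ℚ̄) = ℤ`, (2), (3a), (3b) VERBATIM the siblings'; conclusion VERBATIM the siblings' `GL₄`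
almost-everywhere clause.  This is the statement a T-S certificate row of the cell meets: image
clause = certificate (`IM3-CLASS = N_dec` EXACT: UB decomposition item + LB escapes),
`End(A_ℚ̄) = ℤ` = the TYP slot, local slots as for Theorem A rows.  Its `hSO`-free form
`bcgp2025_modThreeDecompositionImage_modular` (and `bcgp2025_modThreeDecompositionImage_liftingConditions`
for consumers that, like the cell's `modular_of_mod3ListedRowNOS`, want the five image clauses and
derive the local hypotheses from Euler factors) is the consumer-facing statement: its only
non-structural hypotheses are the two printed-theorem facts `h952`, `h2304`.

What is deliberately NOT here: a named fact (the row's fact of record is the sibling's ORDER form;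
R86/R87: one `+1` line per printed row); the other 14 ticked rows (`-- TODO(general form)`); a
proof of conditions (2)–(4) / of the irreducibility directly from `HasDecompositionStabilizerImage`
(they are reached through the image order and the fact of record instead); Lemma 6.4.2 as a
separate fact (folded into "good reduction at `3`", as the printed Lemma 6.4.3 folds it).

## Status

No new fact: every declaration here is a definition-free THEOREM over the tree facts
`bcgp2025_modThreeListedImage_modular_abelianSurface` (Theorem 9.5.2; conditional in print on the
twisted weighted fundamental lemma, §1.6) and `bcgp2025_lemma643_modThreeImage_order2304` (Lemma
6.4.3 / Table 6.4.4 row `3.45.1`; Magma in print, Remark 9.1.5); the finite-group count (S⇒O) is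
the tree theorem `GSp4DecompStabCount.card_stabSet` (`GSp4DecompositionStabilizerCard.lean`), used
here through `natCard_GL_similitude_stabilizesPlanePair`, whose type is `hSO`'s.

## References

* [BoxerCalegariGeePilloni2025] G. Boxer, F. Calegari, T. Gee, V. Pilloni, *Modularity theorems
  for abelian surfaces*, arXiv:2502.20645 (2025): §6.4 Lemma 6.4.1, Lemma 6.4.2 (label
  `imageonly`), Lemma 6.4.3 (label `listofsubgroups`) and its proof, Table 6.4.4 (label `tabletwo`,
  row `3.45.1`), Theorem 9.5.2 (label `firstlater`) and its proof, §10.1 (the curve of conductor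
  `7³ · 23`), §1.8.23, Remark 9.1.5, §1.6.
* [Whitmore2022] D. Whitmore, *The Taylor–Wiles method for reductive groups*, arXiv:2205.05062v4:
  Def. 3.15, Def. 3.19 (p. 24 L1–4), Lemma 3.20, §4.3 and Table 5 (p. 85), §7 p. 69 L39 – p. 70
  L2 ("22 of the 25 such possible images `Γ′` are tidy"), Prop. 8.3 and its proof (pp. 73–74:
  reasonableness of induced images at `p = 3`, Magma).
* [BoxerEtAl2021] G. Boxer, F. Calegari, T. Gee, V. Pilloni, Publ. Math. IHÉS 134 (2021):
  Def. 7.5.11 (tidy), §2.1 (`GSp₄`).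
* [CalegariChidambaramGhitza2019] F. Calegari, S. Chidambaram, A. Ghitza, *Some modular abelian
  surfaces*, Math. Comp. 89 (2020): Lemma 2 (`G₂₃₀₄` is the unique subgroup of order `2304` of
  `GSp₄(𝔽₃)` up to conjugacy) — the bridge used by the fact of record.
* [Milne1986AbelianVarieties] J. S. Milne, *Abelian varieties* (1986), §13 and §16 (polarizations,
  `nλ′` a polarization ⟹ `λ′` one; Weil pairing).
-/

namespace Literature.NumberTheory.DiophantineGeometry

open CategoryTheory IsDedekindDomain
open scoped NumberField Matrix
open Literature.NumberTheory.GaloisRepresentations Literature.NumberTheory.Automorphic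
open Literature.AlgebraicGeometry.Motives (AbelianVariety HasGoodReductionAt)

/-- **The structural image hypothesis gives the image ORDER** (bridge to the fact of record).  If
`ρb : Γ_ℚ → GL₄(𝔽₃)` is symplectic for `J` with multiplier `ε̄⁻¹` and its image is exactly the
stabiliser in `GSp(J)(𝔽₃)` of a non-degenerate plane pair `{P, P^⊥}`
(`FramedGaloisRep.HasDecompositionStabilizerImage`), then `ρb.imageOn ⊤` is in bijection with the
similitudes of `J` stabilising `{P, P^⊥}`, so — granted the finite-group count `hSO` ("(S⇒O)":
those similitudes number `2304 = |GSp₄(𝔽₃)| / 45` for every invertible alternating `J` and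
non-degenerate `P`; module docstring) — `|ρ̄(G_ℚ)| = 2304`, the hypothesis of
`bcgp2025_lemma643_modThreeImage_order2304`.  Bookkeeping, PROVED.
[cite: BoxerCalegariGeePilloni2025, Table 6.4.4 row 3.45.1 (|Γ′| = 2304) and §10.1 ("image of order 2304")] -/
theorem card_imageOn_top_eq_of_hasDecompositionStabilizerImage
    (hSO : ∀ J : Matrix (Fin 4) (Fin 4) (ZMod 3), Jᵀ = -J → IsUnit J.det →
      ∀ P : Submodule (ZMod 3) (Fin 4 → ZMod 3), Submodule.IsNondegeneratePlane J P →
        Nat.card {M : GL (Fin 4) (ZMod 3) //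
          (∃ c : (ZMod 3)ˣ, (M : Matrix (Fin 4) (Fin 4) (ZMod 3))ᵀ * J * M = (c : ZMod 3) • J) ∧
            StabilizesPlanePair J P (M : Matrix (Fin 4) (Fin 4) (ZMod 3))} = 2304)
    (ρb : FramedGaloisRep ℚ (ZMod 3) 4) (J : Matrix (Fin 4) (Fin 4) (ZMod 3)) (hJalt : Jᵀ = -J)
    (hJdet : IsUnit J.det)
    (hsymp : ∀ σ : Field.absoluteGaloisGroup ℚ,
      (ρb σ).valᵀ * J * (ρb σ).val =
        (((modPCyclotomicCharacterZMod ℚ 3 σ)⁻¹ : (ZMod 3)ˣ) : ZMod 3) • J)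
    (himg : ρb.HasDecompositionStabilizerImage J) :
    Nat.card (ρb.imageOn ⊤) = 2304 := by
  obtain ⟨P, hP, hstab, hex⟩ := himg
  rw [← hSO J hJalt hJdet P hP]
  refine Nat.card_congr (Equiv.subtypeEquivRight fun M => ?_)
  constructor
  · intro hM
    obtain ⟨σ, -, rfl⟩ := (ρb.mem_imageOn_iff ⊤ M).1 hM
    exact ⟨⟨(modPCyclotomicCharacterZMod ℚ 3 σ)⁻¹, hsymp σ⟩, hstab σ⟩
  · rintro ⟨hsim, hst⟩
    obtain ⟨σ, hσ⟩ := hex M hsim hst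
    exact (ρb.mem_imageOn_iff ⊤ M).2 ⟨σ, Subgroup.mem_top σ, Units.ext hσ⟩

/-- **Boxer–Calegari–Gee–Pilloni 2025, Lemma 6.4.3 with Table 6.4.4, row `3.45.1` — STRUCTURAL
entry point** (PROVED from the fact of record `bcgp2025_lemma643_modThreeImage_order2304` and the
finite-group count `hSO`).  For every abelian surface `A/ℚ` (`AbelianVariety ℚ`, `dim A = 2`) with
GOOD REDUCTION AT `3`, a torsion frame `(ρ₀, e)` of `A[3](ℚ̄)` and `ρb = ρ₀^∨` (the source's
`ρ̄_{A,3}` on `H¹(A_ℚ̄, 𝔽₃)`), and every invertible alternating `J` for which `ρb` is symplectic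
with multiplier `ε̄⁻¹` ("a prime to `3` polarization", §1.8.23): IF the image `ρ̄(G_ℚ)` is the
stabiliser in `GSp(J)(𝔽₃)` of a non-degenerate decomposition `𝔽₃⁴ = P ⊕ P^⊥`
(`ρb.HasDecompositionStabilizerImage J` — the class `3.45.1 | 2304 | 1152 | ✓` of Table 6.4.4),
THEN the four conditions of Lemma 6.4.3 hold — (1) `ρ̄` is `GSp₄`-reasonable [Whitmore, Def. 3.19]
(`IsGSp4Reasonable`), (2) `ρ̄` is tidy [BCGP 2021, Def. 7.5.11] (`IsTidy`), (3) `ρ̄(G_{ℚ(ζ₃)})`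
contains a regular semisimple element, (4) so does `ρ̄(G_ℚ) ∖ ρ̄(G_{ℚ(ζ₃)})` — and
`Γ = ρ̄(G_{ℚ(ζ₃)})` is absolutely irreducible (the table's caption for that row); stated VERBATIM
as the five image clauses of hypothesis (1) of `bcgp2025_modThreeListedImage_modular_abelianSurface`.
[cite: BoxerCalegariGeePilloni2025, Lemma 6.4.3 (label `listofsubgroups`) with Table 6.4.4 row 3.45.1 (✓) and caption; Lemma 6.4.2 (label `imageonly`); proof of Lemma 6.4.3 (LMFDB label 3.i.n, i = index); §10.1 (image of order 2304); Remark 9.1.5]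
[cite: Whitmore2022, Def. 3.19 (GSp₄-reasonable); Prop. 8.3 and its proof (pp. 73–74)] -/
theorem bcgp2025_modThreeDecompositionImage_liftingConditions_of_order2304
    (h2304 : bcgp2025_lemma643_modThreeImage_order2304)
    (hSO : ∀ J : Matrix (Fin 4) (Fin 4) (ZMod 3), Jᵀ = -J → IsUnit J.det →
      ∀ P : Submodule (ZMod 3) (Fin 4 → ZMod 3), Submodule.IsNondegeneratePlane J P →
        Nat.card {M : GL (Fin 4) (ZMod 3) //
          (∃ c : (ZMod 3)ˣ, (M : Matrix (Fin 4) (Fin 4) (ZMod 3))ᵀ * J * M = (c : ZMod 3) • J) ∧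
            StabilizesPlanePair J P (M : Matrix (Fin 4) (Fin 4) (ZMod 3))} = 2304) :
    ∀ (A : AbelianVariety ℚ), A.dim = 2 →
      ∀ (ρ₀ : FramedGaloisRep ℚ (ZMod 3) 4) (e : A.geomTorsion (3 : ℕ) ≃+ (Fin 4 → ZMod 3))
        (ρb : FramedGaloisRep ℚ (ZMod 3) 4),
        (∀ (σ : Field.absoluteGaloisGroup ℚ) (P : A.geomTorsion (3 : ℕ)),
          e (σ • P) = ((ρ₀ σ : GL (Fin 4) (ZMod 3)) : Matrix (Fin 4) (Fin 4) (ZMod 3)) *ᵥ e P) →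
        FramedRep.dual ρ₀ = ρb →
      -- "good reduction at `3`" (Lemma 6.4.3; via Lemma 6.4.2 it makes reasonableness depend on
      -- the image alone)
      (∀ v : HeightOneSpectrum (𝓞 ℚ), ((3 : ℕ) : 𝓞 ℚ) ∈ v.asIdeal →
        HasGoodReductionAt A.X A.dim v) →
      ∀ J : Matrix (Fin 4) (Fin 4) (ZMod 3), Jᵀ = -J → IsUnit J.det →
        -- "a prime to `3` polarization … `ρ̄ : G_ℚ → GSp₄(𝔽₃)`": symplectic, multiplier `ε̄⁻¹`
        (∀ σ : Field.absoluteGaloisGroup ℚ,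
          (ρb σ).valᵀ * J * (ρb σ).val =
            (((modPCyclotomicCharacterZMod ℚ 3 σ)⁻¹ : (ZMod 3)ˣ) : ZMod 3) • J) →
        -- `Γ′ = ρ̄(G_ℚ)` is the class `3.45.1`: the stabiliser in `GSp(J)` of `{P, P^⊥}`
        ρb.HasDecompositionStabilizerImage J →
        -- Lemma 6.4.3 (1)–(4) and the caption condition, in the sibling's clause shapes
        ρb.IsGSp4Reasonable J 3 ∧ ρb.IsTidy J ∧
          IsAbsIrreducible (ρb.imageOn (galCyclotomicPow ℚ 3 1)).subtype ∧
          (∃ g ∈ ρb.imageOn (galCyclotomicPow ℚ 3 1), IsRegularSemisimple g) ∧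
          (∃ g ∈ ρb.imageOn ⊤, g ∉ ρb.imageOn (galCyclotomicPow ℚ 3 1) ∧ IsRegularSemisimple g) := by
  intro A hA ρ₀ e ρb he hdual hgood J hJalt hJdet hsymp himg
  have hcard : Nat.card (ρb.imageOn ⊤) = 2304 :=
    card_imageOn_top_eq_of_hasDecompositionStabilizerImage hSO ρb J hJalt hJdet hsymp himg
  obtain ⟨⟨hreas, htidy⟩, hirr, hrss, hrss'⟩ :=
    h2304 A hA ρ₀ e ρb he hdual J hJalt hJdet hsymp hgood hcard
  exact ⟨hreas, htidy, hirr, hrss, hrss'⟩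

/-- **Boxer–Calegari–Gee–Pilloni 2025, Theorem 9.5.2 for the listed image `3.45.1`** (the
stabiliser `N_dec` of a non-degenerate decomposition `𝔽₃⁴ = P ⊕ P^⊥`; the case of the curve of
conductor `7³ · 23` of §10.1), PROVED from the general Theorem 9.5.2 fact
`bcgp2025_modThreeListedImage_modular_abelianSurface`, the row's fact of record
`bcgp2025_lemma643_modThreeImage_order2304`, and the finite-group count `hSO` ((S⇒O), module
docstring).  Every abelian surface `A/ℚ` such that, for a torsion frame `(ρ₀, e)` of `A[3](ℚ̄)` and
`ρb = ρ₀^∨`: (0)+(1) `ρb` is symplectic with multiplier `ε̄⁻¹` for an invertible alternating `J`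
and its image is EXACTLY the stabiliser in `GSp(J)(𝔽₃)` of a non-degenerate plane pair `{P, P^⊥}`
(`HasDecompositionStabilizerImage`: "the image of `ρ̄_{A,3}` is one of the 15 subgroups listed in
Lemma 6.4.3", here `3.45.1`), and `End(A_ℚ̄) = ℤ` (every endomorphism of `A_ℚ̄` is `n · 𝟙`);
(2) `ρb` is unramified at `2` with Frobenius characteristic polynomial `≠ (X² ± X + 2)²`;
(3) `A` has good ordinary reduction at `3` and is `3`-distinguished (for every `ℓ ≠ 3` the framed
dual of `V_ℓ(A)` is unramified at `3` with separable Frobenius characteristic polynomial) — is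
MODULAR in the `GL₄` almost-everywhere form (VERBATIM the conclusion clause of
`bcgp2025_modThreeSurjective_modular_abelianSurface`).
[cite: BoxerCalegariGeePilloni2025, Theorem 9.5.2 (label `firstlater`) with Lemma 6.4.3 / Table 6.4.4 row 3.45.1; §10.1 (the curve of conductor 7³·23)] -/
theorem bcgp2025_modThreeDecompositionImage_modular_abelianSurface
    (h952 : bcgp2025_modThreeListedImage_modular_abelianSurface)
    (h2304 : bcgp2025_lemma643_modThreeImage_order2304)
    (hSO : ∀ J : Matrix (Fin 4) (Fin 4) (ZMod 3), Jᵀ = -J → IsUnit J.det →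
      ∀ P : Submodule (ZMod 3) (Fin 4 → ZMod 3), Submodule.IsNondegeneratePlane J P →
        Nat.card {M : GL (Fin 4) (ZMod 3) //
          (∃ c : (ZMod 3)ˣ, (M : Matrix (Fin 4) (Fin 4) (ZMod 3))ᵀ * J * M = (c : ZMod 3) • J) ∧
            StabilizesPlanePair J P (M : Matrix (Fin 4) (Fin 4) (ZMod 3))} = 2304) :
    ∀ (A : AbelianVariety ℚ), A.dim = 2 →
      ∀ (ρ₀ : FramedGaloisRep ℚ (ZMod 3) 4) (e : A.geomTorsion (3 : ℕ) ≃+ (Fin 4 → ZMod 3))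
        (ρb : FramedGaloisRep ℚ (ZMod 3) 4),
        (∀ (σ : Field.absoluteGaloisGroup ℚ) (P : A.geomTorsion (3 : ℕ)),
          e (σ • P) = ((ρ₀ σ : GL (Fin 4) (ZMod 3)) : Matrix (Fin 4) (Fin 4) (ZMod 3)) *ᵥ e P) →
        FramedRep.dual ρ₀ = ρb →
      -- (0)+(1): symplectic with multiplier `ε̄⁻¹` for `J`, image `= Stab_{GSp(J)}({P, P^⊥})`
      (∃ J : Matrix (Fin 4) (Fin 4) (ZMod 3), Jᵀ = -J ∧ IsUnit J.det ∧
        (∀ σ : Field.absoluteGaloisGroup ℚ,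
          (ρb σ).valᵀ * J * (ρb σ).val =
            (((modPCyclotomicCharacterZMod ℚ 3 σ)⁻¹ : (ZMod 3)ˣ) : ZMod 3) • J) ∧
        ρb.HasDecompositionStabilizerImage J) →
      -- (1): `End(A_ℚ̄) = ℤ`
      (∀ f : A.baseChange (AlgebraicClosure ℚ) ⟶ A.baseChange (AlgebraicClosure ℚ),
        ∃ n : ℤ, f = n • 𝟙 (A.baseChange (AlgebraicClosure ℚ))) →
      -- (2): unramified at `2`, `charpoly ρ̄_{A,3}(Frob₂) ≠ (X² ± X + 2)²`
      (∀ v : HeightOneSpectrum (𝓞 ℚ), ((2 : ℕ) : 𝓞 ℚ) ∈ v.asIdeal →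
        ρb.IsUnramifiedAt v ∧
          ∀ Q : Polynomial (ZMod 3), ρb.HasFrobCharpolyAt v Q →
            Q ≠ (Polynomial.X ^ 2 + Polynomial.X + 2) ^ 2 ∧
              Q ≠ (Polynomial.X ^ 2 - Polynomial.X + 2) ^ 2) →
      -- (3a): good ordinary reduction at `3`
      (∀ v : HeightOneSpectrum (𝓞 ℚ), ((3 : ℕ) : 𝓞 ℚ) ∈ v.asIdeal →
        A.HasGoodOrdinaryReductionAt v) →
      -- (3b): `3`-distinguished
      (∀ (ℓ : ℕ) [Fact ℓ.Prime], ℓ ≠ 3 →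
        ∀ (b : Module.Basis (Fin 4) ℚ_[ℓ] (A.rationalTateModule ℓ))
          (r : FramedGaloisRep ℚ (PadicAlgCl ℓ) 4),
          (∀ g : Field.absoluteGaloisGroup ℚ,
            (r g).val =
              ((LinearMap.toMatrix b b (A.rationalTateRep ℓ g⁻¹)).map
                (algebraMap ℚ_[ℓ] (PadicAlgCl ℓ))).transpose) →
          ∀ v : HeightOneSpectrum (𝓞 ℚ), ((3 : ℕ) : 𝓞 ℚ) ∈ v.asIdeal →
            r.IsUnramifiedAt v ∧
              ∀ Q : Polynomial (PadicAlgCl ℓ), r.HasFrobCharpolyAt v Q → Q.Separable) →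
      -- conclusion: `A` is modular (`GL₄` almost-everywhere form)
      ∀ (p : ℕ) [Fact p.Prime] (b : Module.Basis (Fin 4) ℚ_[p] (A.rationalTateModule p))
        (r : FramedGaloisRep ℚ (PadicAlgCl p) 4),
        (∀ g : Field.absoluteGaloisGroup ℚ,
          (r g).val =
            ((LinearMap.toMatrix b b (A.rationalTateRep p g⁻¹)).map
              (algebraMap ℚ_[p] (PadicAlgCl p))).transpose) →
        ∀ (hcpt : isCompact_glFiniteIntegralLevel 4 ℚ) (ι : PadicAlgCl p ≃+* ℂ),
          ∃ π : CuspidalAutomorphicRepData 4 ℚ hcpt, π.1.IsLAlgebraic ∧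
            ∀ᶠ v : HeightOneSpectrum (𝓞 ℚ) in Filter.cofinite, ∃ a : Multiset ℂ,
              π.1.HasSatakeParamAt v a ∧ r.IsUnramifiedAt v ∧
                r.HasFrobCharpolyAt v (arithFrobPolyOfSatake ι v.residueCard 1 a) := by
  intro A hA ρ₀ e ρb he hdual hJ hEnd h2 h3a h3b
  obtain ⟨J, hJalt, hJdet, hsymp, himg⟩ := hJ
  obtain ⟨hreas, htidy, hirr, hrss, hrss'⟩ :=
    bcgp2025_modThreeDecompositionImage_liftingConditions_of_order2304 h2304 hSO A hA ρ₀ e ρb he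
      hdual (hasGoodReductionAt_three_of_hasGoodOrdinaryReductionAt A h3a) J hJalt hJdet hsymp himg
  exact h952 A hA ρ₀ e ρb he hdual ⟨J, hJalt, hJdet, hsymp, hreas, htidy⟩ hirr hrss hrss' hEnd h2
    h3a h3b

/-!
## The same three statements with (S⇒O) discharged

(S⇒O) — for an invertible alternating `J` on `𝔽₃⁴` and a non-degenerate plane `P`, the similitudes
of `J` in `GL₄(𝔽₃)` stabilising `{P, P^⊥}` number `2304` — is the tree theorem
`natCard_GL_similitude_stabilizesPlanePair` (from `GSp4DecompStabCount.card_stabSet`,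
`GaloisRepresentations/GSp4DecompositionStabilizerCard.lean`), whose type is, character for
character, the binder `hSO` of the three theorems above.  The three theorems below are those three
applied to it: the same statements with `hSO` removed; nothing else changes.
-/

/-- **The structural image hypothesis gives the image ORDER, unconditionally.**  If
`ρb : Γ_ℚ → GL₄(𝔽₃)` is symplectic for an invertible alternating `J` with multiplier `ε̄⁻¹` and
its image is exactly the stabiliser in `GSp(J)(𝔽₃)` of a non-degenerate plane pair `{P, P^⊥}`
(`FramedGaloisRep.HasDecompositionStabilizerImage`, the class `3.45.1` of Table 6.4.4), then
`|ρ̄(G_ℚ)| = 2304` — the hypothesis `hcard` of the fact of record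
`bcgp2025_lemma643_modThreeImage_order2304`.  This is
`card_imageOn_top_eq_of_hasDecompositionStabilizerImage` with `hSO` discharged by the tree's count
`natCard_GL_similitude_stabilizesPlanePair`.  PROVED.  (For an arbitrary base field and multiplier
see `FramedGaloisRep.natCard_imageOn_top_of_hasDecompositionStabilizerImage` in
`GSp4DecompositionStabilizerCard.lean`.)
[cite: BoxerCalegariGeePilloni2025, Table 6.4.4 row 3.45.1 (|Γ′| = 2304) and §10.1 ("image of order 2304")]
[cite: CalegariChidambaramGhitza2019, Lemma 2] -/
theorem card_imageOn_top_eq_2304_of_hasDecompositionStabilizerImage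
    (ρb : FramedGaloisRep ℚ (ZMod 3) 4) (J : Matrix (Fin 4) (Fin 4) (ZMod 3)) (hJalt : Jᵀ = -J)
    (hJdet : IsUnit J.det)
    (hsymp : ∀ σ : Field.absoluteGaloisGroup ℚ,
      (ρb σ).valᵀ * J * (ρb σ).val =
        (((modPCyclotomicCharacterZMod ℚ 3 σ)⁻¹ : (ZMod 3)ˣ) : ZMod 3) • J)
    (himg : ρb.HasDecompositionStabilizerImage J) :
    Nat.card (ρb.imageOn ⊤) = 2304 :=
  card_imageOn_top_eq_of_hasDecompositionStabilizerImage natCard_GL_similitude_stabilizesPlanePair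
    ρb J hJalt hJdet hsymp himg

/-- **Boxer–Calegari–Gee–Pilloni 2025, Lemma 6.4.3 with Table 6.4.4, row `3.45.1` — STRUCTURAL
entry point, (S⇒O) discharged** (PROVED from the fact of record
`bcgp2025_lemma643_modThreeImage_order2304` alone).  For every abelian surface `A/ℚ`
(`AbelianVariety ℚ`, `dim A = 2`) with GOOD REDUCTION AT `3`, a torsion frame `(ρ₀, e)` of
`A[3](ℚ̄)` and `ρb = ρ₀^∨` (the source's `ρ̄_{A,3}` on `H¹(A_ℚ̄, 𝔽₃)`), and every invertible
alternating `J` for which `ρb` is symplectic with multiplier `ε̄⁻¹` ("a prime to `3` polarization",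
§1.8.23): IF the image `ρ̄(G_ℚ)` is the stabiliser in `GSp(J)(𝔽₃)` of a non-degenerate
decomposition `𝔽₃⁴ = P ⊕ P^⊥` (`ρb.HasDecompositionStabilizerImage J` — the class
`3.45.1 | 2304 | 1152 | ✓` of Table 6.4.4), THEN the four conditions of Lemma 6.4.3 hold —
(1) `ρ̄` is `GSp₄`-reasonable [Whitmore, Def. 3.19] (`IsGSp4Reasonable`), (2) `ρ̄` is tidy
[BCGP 2021, Def. 7.5.11] (`IsTidy`), (3) `ρ̄(G_{ℚ(ζ₃)})` contains a regular semisimple element,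
(4) so does `ρ̄(G_ℚ) ∖ ρ̄(G_{ℚ(ζ₃)})` — and `Γ = ρ̄(G_{ℚ(ζ₃)})` is absolutely irreducible (the
table's caption for that row); stated VERBATIM as the five image clauses of hypothesis (1) of
`bcgp2025_modThreeListedImage_modular_abelianSurface`.  Same statement as
`bcgp2025_modThreeDecompositionImage_liftingConditions_of_order2304` without the binder `hSO`.
[cite: BoxerCalegariGeePilloni2025, Lemma 6.4.3 (label `listofsubgroups`) with Table 6.4.4 row 3.45.1 (✓) and caption; Lemma 6.4.2 (label `imageonly`); proof of Lemma 6.4.3 (LMFDB label 3.i.n, i = index); §10.1 (image of order 2304); Remark 9.1.5]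
[cite: Whitmore2022, Def. 3.19 (GSp₄-reasonable); Prop. 8.3 and its proof (pp. 73–74)] -/
theorem bcgp2025_modThreeDecompositionImage_liftingConditions
    (h2304 : bcgp2025_lemma643_modThreeImage_order2304) :
    ∀ (A : AbelianVariety ℚ), A.dim = 2 →
      ∀ (ρ₀ : FramedGaloisRep ℚ (ZMod 3) 4) (e : A.geomTorsion (3 : ℕ) ≃+ (Fin 4 → ZMod 3))
        (ρb : FramedGaloisRep ℚ (ZMod 3) 4),
        (∀ (σ : Field.absoluteGaloisGroup ℚ) (P : A.geomTorsion (3 : ℕ)),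
          e (σ • P) = ((ρ₀ σ : GL (Fin 4) (ZMod 3)) : Matrix (Fin 4) (Fin 4) (ZMod 3)) *ᵥ e P) →
        FramedRep.dual ρ₀ = ρb →
      -- "good reduction at `3`" (Lemma 6.4.3; via Lemma 6.4.2 it makes reasonableness depend on
      -- the image alone)
      (∀ v : HeightOneSpectrum (𝓞 ℚ), ((3 : ℕ) : 𝓞 ℚ) ∈ v.asIdeal →
        HasGoodReductionAt A.X A.dim v) →
      ∀ J : Matrix (Fin 4) (Fin 4) (ZMod 3), Jᵀ = -J → IsUnit J.det →
        -- "a prime to `3` polarization … `ρ̄ : G_ℚ → GSp₄(𝔽₃)`": symplectic, multiplier `ε̄⁻¹`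
        (∀ σ : Field.absoluteGaloisGroup ℚ,
          (ρb σ).valᵀ * J * (ρb σ).val =
            (((modPCyclotomicCharacterZMod ℚ 3 σ)⁻¹ : (ZMod 3)ˣ) : ZMod 3) • J) →
        -- `Γ′ = ρ̄(G_ℚ)` is the class `3.45.1`: the stabiliser in `GSp(J)` of `{P, P^⊥}`
        ρb.HasDecompositionStabilizerImage J →
        -- Lemma 6.4.3 (1)–(4) and the caption condition, in the sibling's clause shapes
        ρb.IsGSp4Reasonable J 3 ∧ ρb.IsTidy J ∧
          IsAbsIrreducible (ρb.imageOn (galCyclotomicPow ℚ 3 1)).subtype ∧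
          (∃ g ∈ ρb.imageOn (galCyclotomicPow ℚ 3 1), IsRegularSemisimple g) ∧
          (∃ g ∈ ρb.imageOn ⊤, g ∉ ρb.imageOn (galCyclotomicPow ℚ 3 1) ∧ IsRegularSemisimple g) :=
  bcgp2025_modThreeDecompositionImage_liftingConditions_of_order2304 h2304
    natCard_GL_similitude_stabilizesPlanePair

/-- **Boxer–Calegari–Gee–Pilloni 2025, Theorem 9.5.2 for the listed image `3.45.1`, (S⇒O)
discharged** (the stabiliser `N_dec` of a non-degenerate decomposition `𝔽₃⁴ = P ⊕ P^⊥`; the case of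
the curve of conductor `7³ · 23` of §10.1), PROVED from the general Theorem 9.5.2 fact
`bcgp2025_modThreeListedImage_modular_abelianSurface` and the row's fact of record
`bcgp2025_lemma643_modThreeImage_order2304` — nothing else.  Every abelian surface `A/ℚ` such that,
for a torsion frame `(ρ₀, e)` of `A[3](ℚ̄)` and `ρb = ρ₀^∨`: (0)+(1) `ρb` is symplectic with
multiplier `ε̄⁻¹` for an invertible alternating `J` and its image is EXACTLY the stabiliser in
`GSp(J)(𝔽₃)` of a non-degenerate plane pair `{P, P^⊥}` (`HasDecompositionStabilizerImage`: "the
image of `ρ̄_{A,3}` is one of the 15 subgroups listed in Lemma 6.4.3", here `3.45.1`), and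
`End(A_ℚ̄) = ℤ` (every endomorphism of `A_ℚ̄` is `n · 𝟙`); (2) `ρb` is unramified at `2` with
Frobenius characteristic polynomial `≠ (X² ± X + 2)²`; (3) `A` has good ordinary reduction at `3`
and is `3`-distinguished (for every `ℓ ≠ 3` the framed dual of `V_ℓ(A)` is unramified at `3` with
separable Frobenius characteristic polynomial) — is MODULAR in the `GL₄` almost-everywhere form
(VERBATIM the conclusion clause of `bcgp2025_modThreeSurjective_modular_abelianSurface`).  Same
statement as `bcgp2025_modThreeDecompositionImage_modular_abelianSurface` without the binder `hSO`.
[cite: BoxerCalegariGeePilloni2025, Theorem 9.5.2 (label `firstlater`) with Lemma 6.4.3 / Table 6.4.4 row 3.45.1; §10.1 (the curve of conductor 7³·23)] -/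
theorem bcgp2025_modThreeDecompositionImage_modular
    (h952 : bcgp2025_modThreeListedImage_modular_abelianSurface)
    (h2304 : bcgp2025_lemma643_modThreeImage_order2304) :
    ∀ (A : AbelianVariety ℚ), A.dim = 2 →
      ∀ (ρ₀ : FramedGaloisRep ℚ (ZMod 3) 4) (e : A.geomTorsion (3 : ℕ) ≃+ (Fin 4 → ZMod 3))
        (ρb : FramedGaloisRep ℚ (ZMod 3) 4),
        (∀ (σ : Field.absoluteGaloisGroup ℚ) (P : A.geomTorsion (3 : ℕ)),
          e (σ • P) = ((ρ₀ σ : GL (Fin 4) (ZMod 3)) : Matrix (Fin 4) (Fin 4) (ZMod 3)) *ᵥ e P) →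
        FramedRep.dual ρ₀ = ρb →
      -- (0)+(1): symplectic with multiplier `ε̄⁻¹` for `J`, image `= Stab_{GSp(J)}({P, P^⊥})`
      (∃ J : Matrix (Fin 4) (Fin 4) (ZMod 3), Jᵀ = -J ∧ IsUnit J.det ∧
        (∀ σ : Field.absoluteGaloisGroup ℚ,
          (ρb σ).valᵀ * J * (ρb σ).val =
            (((modPCyclotomicCharacterZMod ℚ 3 σ)⁻¹ : (ZMod 3)ˣ) : ZMod 3) • J) ∧
        ρb.HasDecompositionStabilizerImage J) →
      -- (1): `End(A_ℚ̄) = ℤ`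
      (∀ f : A.baseChange (AlgebraicClosure ℚ) ⟶ A.baseChange (AlgebraicClosure ℚ),
        ∃ n : ℤ, f = n • 𝟙 (A.baseChange (AlgebraicClosure ℚ))) →
      -- (2): unramified at `2`, `charpoly ρ̄_{A,3}(Frob₂) ≠ (X² ± X + 2)²`
      (∀ v : HeightOneSpectrum (𝓞 ℚ), ((2 : ℕ) : 𝓞 ℚ) ∈ v.asIdeal →
        ρb.IsUnramifiedAt v ∧
          ∀ Q : Polynomial (ZMod 3), ρb.HasFrobCharpolyAt v Q →
            Q ≠ (Polynomial.X ^ 2 + Polynomial.X + 2) ^ 2 ∧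
              Q ≠ (Polynomial.X ^ 2 - Polynomial.X + 2) ^ 2) →
      -- (3a): good ordinary reduction at `3`
      (∀ v : HeightOneSpectrum (𝓞 ℚ), ((3 : ℕ) : 𝓞 ℚ) ∈ v.asIdeal →
        A.HasGoodOrdinaryReductionAt v) →
      -- (3b): `3`-distinguished
      (∀ (ℓ : ℕ) [Fact ℓ.Prime], ℓ ≠ 3 →
        ∀ (b : Module.Basis (Fin 4) ℚ_[ℓ] (A.rationalTateModule ℓ))
          (r : FramedGaloisRep ℚ (PadicAlgCl ℓ) 4),
          (∀ g : Field.absoluteGaloisGroup ℚ,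
            (r g).val =
              ((LinearMap.toMatrix b b (A.rationalTateRep ℓ g⁻¹)).map
                (algebraMap ℚ_[ℓ] (PadicAlgCl ℓ))).transpose) →
          ∀ v : HeightOneSpectrum (𝓞 ℚ), ((3 : ℕ) : 𝓞 ℚ) ∈ v.asIdeal →
            r.IsUnramifiedAt v ∧
              ∀ Q : Polynomial (PadicAlgCl ℓ), r.HasFrobCharpolyAt v Q → Q.Separable) →
      -- conclusion: `A` is modular (`GL₄` almost-everywhere form)
      ∀ (p : ℕ) [Fact p.Prime] (b : Module.Basis (Fin 4) ℚ_[p] (A.rationalTateModule p))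
        (r : FramedGaloisRep ℚ (PadicAlgCl p) 4),
        (∀ g : Field.absoluteGaloisGroup ℚ,
          (r g).val =
            ((LinearMap.toMatrix b b (A.rationalTateRep p g⁻¹)).map
              (algebraMap ℚ_[p] (PadicAlgCl p))).transpose) →
        ∀ (hcpt : isCompact_glFiniteIntegralLevel 4 ℚ) (ι : PadicAlgCl p ≃+* ℂ),
          ∃ π : CuspidalAutomorphicRepData 4 ℚ hcpt, π.1.IsLAlgebraic ∧
            ∀ᶠ v : HeightOneSpectrum (𝓞 ℚ) in Filter.cofinite, ∃ a : Multiset ℂ,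
              π.1.HasSatakeParamAt v a ∧ r.IsUnramifiedAt v ∧
                r.HasFrobCharpolyAt v (arithFrobPolyOfSatake ι v.residueCard 1 a) :=
  bcgp2025_modThreeDecompositionImage_modular_abelianSurface h952 h2304
    natCard_GL_similitude_stabilizesPlanePair

end Literature.NumberTheory.DiophantineGeometry
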